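import Mathlib
import HarnessLib

/-!
# Route SchenstedIndex — block partitions of the slot set with prescribed label multisets
# (step (c-comb) of the blueprint for `BorderPcPerThree` AS TYPED, stmt-ValiantsHypothesis-16085)

Pure combinatorics, route-independent (imports `Mathlib` + `HarnessLib` only), written by val-lit-p5 g7
as the second hand named by the owner of the blueprint (val-lit-p8 g6, bus 2026-08-27T11:06:46Z;
lead-lmr split of record 11:07:09Z).

The slot set of the sector `t · J_m` is `S = Fin t × Fin m × Fin m`; the slot `s = (k, ℓ)` carries the
LABEL `ℓ = s.2 ∈ Fin m × Fin m` (a matrix position), and each label has exactly `t` slots.  A monomial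
of torus weight `t · J` in the coefficients `c_α` of an `m`-form is a product of `t · m` coefficients
`c_(d_0) ⋯ c_(d_(tm-1))` whose exponent vectors `d_j : Fin m × Fin m →₀ ℕ` have total degree `m` and
add up to `t · 𝟙` (every label used `t` times in all).  **`exists_blockPartition_of_labelCount`**: such
a family `d` is the family of LABEL MULTISETS of an `m`-block partition of `S` — there is a partition
`π` of `S` into blocks of size `m` and a bijection `β : Fin (t m) ≃ π.parts` with
`∑_(s ∈ β j) e_(s.2) = d_j` for every `j`.  Construction: for each label `ℓ`, hand its `t` slots
`(k, ℓ)`, `k = 0, …, t − 1`, to the blocks in increasing order of `j`, `d_j(ℓ)` consecutive slots each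
(prefix sums, `finSigmaFinEquiv` along `∑_j d_j(ℓ) = t`); the blocks are the fibres of the resulting
slot-to-block map (`exists_finpartition_of_fibres`).

Degree hypothesis: stated in the owner's form `(d j).sum (fun _ n => n) = m`
(`= (d j).degree = ∑ ℓ, d j ℓ`).

HONEST FRAMING: bookkeeping for an OPEN calibration item (`n = 3` instance of a route SUPPORT item);
nothing here bears on `VP ≠ VNP`.
-/

set_option linter.dupNamespace false

namespace Summit.ValiantsHypothesis.ValiantsHypothesis.Theorems.SchenstedIndex

open Finset

/-! ## Fibres of a map as a `Finpartition` -/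

/-- The nonempty fibres of a map `f : S → J` out of a finite type whose every fibre is nonempty form a
finpartition of `univ`, with the parts in bijection with `J` through `j ↦ f⁻¹(j)`. -/
theorem exists_finpartition_of_fibres {S J : Type*} [Fintype S] [DecidableEq S] [Fintype J]
    [DecidableEq J] (f : S → J) (hne : ∀ j, ∃ s, f s = j) :
    ∃ π : Finpartition (Finset.univ : Finset S), ∃ β : J ≃ ↥π.parts,
      ∀ j, ((β j : ↥π.parts) : Finset S) = ({s | f s = j} : Finset S) := by
  classical
  let fib : J → Finset S := fun j => ({s | f s = j} : Finset S)
  have hfib_ne : ∀ j, (fib j).Nonempty := fun j => by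
    obtain ⟨s, hs⟩ := hne j
    exact ⟨s, by simp [fib, hs]⟩
  have hmem : ∀ j s, s ∈ fib j ↔ f s = j := fun j s => by simp [fib]
  let parts : Finset (Finset S) := Finset.univ.image fib
  have hsub : ∀ p ∈ parts, p ⊆ Finset.univ := fun p _ => Finset.subset_univ p
  have huniq : ∀ a ∈ (Finset.univ : Finset S), ∃! p ∈ parts, a ∈ p := by
    intro a _
    refine ⟨fib (f a), ⟨Finset.mem_image_of_mem _ (Finset.mem_univ _), (hmem _ _).2 rfl⟩, ?_⟩
    rintro p ⟨hp, hap⟩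
    obtain ⟨j, -, rfl⟩ := Finset.mem_image.1 hp
    rw [(hmem j a).1 hap]
  have hempty : (∅ : Finset S) ∉ parts := by
    intro h
    obtain ⟨j, -, hj⟩ := Finset.mem_image.1 h
    exact (hfib_ne j).ne_empty hj
  let π : Finpartition (Finset.univ : Finset S) := Finpartition.ofExistsUnique parts hsub huniq hempty
  have hparts : π.parts = parts := rfl
  have hinj : Function.Injective fib := by
    intro j₁ j₂ h
    obtain ⟨s, hs⟩ := hfib_ne j₁
    have hs₂ : s ∈ fib j₂ := by rw [← h]; exact hs
    exact ((hmem _ _).1 hs).symm.trans ((hmem _ _).1 hs₂)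
  let β₀ : J → ↥π.parts := fun j => ⟨fib j, by
    rw [hparts]; exact Finset.mem_image_of_mem _ (Finset.mem_univ _)⟩
  have hβ₀ : Function.Bijective β₀ := by
    refine ⟨fun j₁ j₂ h => hinj (congrArg Subtype.val h), fun p => ?_⟩
    obtain ⟨j, -, hj⟩ := Finset.mem_image.1 (show (p : Finset S) ∈ Finset.univ.image fib from p.2)
    exact ⟨j, Subtype.ext hj⟩
  exact ⟨π, Equiv.ofBijective β₀ hβ₀, fun j => rfl⟩

/-! ## Handing the `t` slots of one label to the blocks -/

/-- If `e : Fin t ≃ Σ j, Fin (c j)`, the map `k ↦ (e k).1` has fibre of size `c j` over `j`. -/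
theorem card_filter_fst_equiv_eq {t : ℕ} {J : Type*} [Fintype J] [DecidableEq J] (c : J → ℕ)
    (e : Fin t ≃ Σ j : J, Fin (c j)) (j : J) :
    #({k : Fin t | (e k).1 = j} : Finset (Fin t)) = c j := by
  classical
  have h1 : #({k : Fin t | (e k).1 = j} : Finset (Fin t)) =
      #({x : (Σ j : J, Fin (c j)) | x.1 = j} : Finset (Σ j : J, Fin (c j))) := by
    refine Finset.card_equiv e ?_
    intro k
    simp
  rw [h1]
  have h2 : ({x : (Σ j : J, Fin (c j)) | x.1 = j} : Finset (Σ j : J, Fin (c j))) =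
      ({j} : Finset J).sigma fun j' => (Finset.univ : Finset (Fin (c j'))) := by
    ext x
    simp [Finset.mem_sigma]
  rw [h2, Finset.card_sigma, Finset.sum_singleton, Finset.card_univ, Fintype.card_fin]

/-! ## The theorem -/

/-- **Block partitions with prescribed label multisets** (step (c-comb) of the `BorderPcPerThree`
blueprint, signature fixed by the owner val-lit-p8 g6).  Let `d_j : Fin m × Fin m →₀ ℕ`
(`j < t·m`) be exponent vectors of total degree `m` (`(d j).sum (fun _ n => n) = m`) with
`∑_j d_j = t · ∑_ℓ e_ℓ` (every label `ℓ` is used exactly `t` times in all).  Then the slot set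
`S = Fin t × Fin m × Fin m` (slot `s` labelled by `s.2`) has a partition `π` into blocks of size `m`
and a bijection `β : Fin (t·m) ≃ π.parts` such that the label multiset of the block `β j` is `d_j`:
`∑_(s ∈ β j) e_(s.2) = d_j`.  (`0 < m` makes the blocks nonempty; for `m = 0` there is nothing to
partition.)  Proof: per label, prefix sums (`finSigmaFinEquiv`); blocks = fibres. -/
theorem exists_blockPartition_of_labelCount {t m : ℕ} (hm : 0 < m)
    (d : Fin (t * m) → (Fin m × Fin m →₀ ℕ)) (hdeg : ∀ j, (d j).sum (fun _ n => n) = m)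
    (hcount : ∑ j, d j = t • ∑ ℓ : Fin m × Fin m, Finsupp.single ℓ 1) :
    ∃ π : {π : Finpartition (Finset.univ : Finset (Fin t × Fin m × Fin m)) //
        ∀ B ∈ π.parts, B.card = m},
      ∃ β : Fin (t * m) ≃ ↥π.1.parts,
        ∀ j, (∑ s ∈ ((β j : ↥π.1.parts) : Finset (Fin t × Fin m × Fin m)),
          Finsupp.single s.2 1) = d j := by
  classical
  -- every label is used exactly `t` times
  have hlab : ∀ ℓ : Fin m × Fin m, ∑ j, d j ℓ = t := by
    intro ℓ
    have h := congrArg (fun g : (Fin m × Fin m →₀ ℕ) => g ℓ) hcount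
    simp only [Finsupp.coe_finsetSum, Finset.sum_apply, Finsupp.coe_smul, Pi.smul_apply,
      Finsupp.single_apply, smul_eq_mul] at h
    rw [h, Finset.sum_ite_eq' Finset.univ ℓ (fun _ => (1 : ℕ))]
    simp
  -- per label: `Fin t ≃ Σ j, Fin (d j ℓ)` (prefix sums)
  let e : ∀ ℓ : Fin m × Fin m, Fin t ≃ Σ j : Fin (t * m), Fin (d j ℓ) := fun ℓ =>
    (finCongr (hlab ℓ).symm).trans finSigmaFinEquiv.symm
  -- slot ↦ block
  let f : Fin t × Fin m × Fin m → Fin (t * m) := fun s => (e s.2 s.1).1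
  -- label counts of the fibres
  have hcnt : ∀ j ℓ, #({s : Fin t × Fin m × Fin m | f s = j ∧ s.2 = ℓ} :
      Finset (Fin t × Fin m × Fin m)) = d j ℓ := by
    intro j ℓ
    have hmap : ({s : Fin t × Fin m × Fin m | f s = j ∧ s.2 = ℓ} :
        Finset (Fin t × Fin m × Fin m)) =
        (({k : Fin t | (e ℓ k).1 = j} : Finset (Fin t)).map
          ⟨fun k => (k, ℓ), fun k₁ k₂ h => (Prod.mk.inj h).1⟩) := by
      ext ⟨k, ℓ'⟩
      simp only [Finset.mem_filter, Finset.mem_univ, true_and, Finset.mem_map,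
        Function.Embedding.coeFn_mk, Prod.mk.injEq, f]
      constructor
      · rintro ⟨h1, rfl⟩
        exact ⟨k, h1, rfl, rfl⟩
      · rintro ⟨k', h1, rfl, rfl⟩
        exact ⟨h1, rfl⟩
    rw [hmap, Finset.card_map, card_filter_fst_equiv_eq (fun j => d j ℓ) (e ℓ) j]
  have hsum : ∀ j, (∑ s ∈ ({s : Fin t × Fin m × Fin m | f s = j} : Finset _),
      Finsupp.single s.2 (1 : ℕ)) = d j := by
    intro j
    ext ℓ
    rw [Finsupp.coe_finsetSum, Finset.sum_apply]
    simp only [Finsupp.single_apply]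
    rw [Finset.sum_boole, Nat.cast_id, Finset.filter_filter]
    exact hcnt j ℓ
  -- block sizes
  have hcard : ∀ j, #({s : Fin t × Fin m × Fin m | f s = j} : Finset _) = m := by
    intro j
    have h : ((∑ s ∈ ({s : Fin t × Fin m × Fin m | f s = j} : Finset _),
        Finsupp.single s.2 (1 : ℕ)).sum fun _ n => n) = (d j).sum fun _ n => n := by
      rw [hsum j]
    rw [hdeg j, ← Finsupp.sum_finsetSum_index (h := fun (_ : Fin m × Fin m) (n : ℕ) => n)
      (fun _ => rfl) (fun _ _ _ => rfl)] at h
    simp only [Finsupp.sum_single_index, Finset.sum_const, smul_eq_mul, mul_one] at h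
    exact h
  -- nonempty fibres
  have hne : ∀ j, ∃ s, f s = j := by
    intro j
    by_contra h
    push Not at h
    have h0 : ({s : Fin t × Fin m × Fin m | f s = j} : Finset _) = ∅ := by
      ext s; simp [h s]
    have := hcard j
    rw [h0, Finset.card_empty] at this
    omega
  obtain ⟨π, β, hβ⟩ := exists_finpartition_of_fibres f hne
  refine ⟨⟨π, fun B hB => ?_⟩, β, fun j => ?_⟩
  · obtain ⟨j, rfl⟩ : ∃ j, ((β j : ↥π.parts) : Finset _) = B :=
      ⟨β.symm ⟨B, hB⟩, by simp⟩
    rw [hβ j, hcard j]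
  · change (∑ s ∈ ((β j : ↥π.parts) : Finset (Fin t × Fin m × Fin m)), Finsupp.single s.2 1) = d j
    rw [hβ j, hsum j]

end Summit.ValiantsHypothesis.ValiantsHypothesis.Theorems.SchenstedIndex
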